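import Literature.Geometry.Riemannian.TwistorCouplingModel
import Literature.Geometry.Riemannian.TwistorFrameChange
import Literature.Geometry.Lorentzian.ChartMetricCoord
import HarnessLib

/-!
# The connection and curvature vectors of `Λ⁺` in a chart: structure equation `F = dc + c × c`
(topic `Geometry/Riemannian`; support for `exists_twistorSpace`, `TwistorPackage.lean`)

Chart-level bridge between the metric data and the model coupling form of
`TwistorCouplingModel.lean`. Setting (that of `ChartCalculus.lean` / `ChartMetricCoord.lean`): an
open subset `U : Opens E` of a finite-dimensional real normed space, a smooth metric `g` on the
open submanifold `U` with representative `G` (`g.val y = G y`), and a frame field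
`ê : Fin 4 → E → E`, smooth on `U` and `g`-orthonormal at every point of `U` (`dim E = 4`). With the
Christoffel map `Γ = chrAt G` and the curvature endomorphism `R = riemAt G` of the components
(`CoordCurvature.lean`) we define

* `covD G u p y = Dp(y) u + Γ_y(u, p y)` — the covariant derivative of a vector-valued function
  along the constant field `u` (the coordinate formula `OpensChart.leviCivita_apply_eq`);
* `chartConnVec G ê y u`, `(c(u))ᵢ = Σ_{(a,b) ∈ φᵢ} G(ê_b, ∇_u ê_a)` — the connection vector of
  `Λ⁺` in the frame (the chart form of `selfDualConnectionVec`), bundled as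
  `chartConn G ê : E → E →L[ℝ] ℝ³`;
* `chartCurvVec G ê y u v`, `(Φ(u,v))ᵢ = Σ_{(a,b) ∈ φᵢ} G(R(u,v) ê_a, ê_b)` — the curvature vector
  (the chart form of `selfDualCurvatureVec`);

and prove the **structure equation** `modelCurv (chartConn G ê) y u v = chartCurvVec G ê y u v`
on `U` (`modelCurv_chartConn`): `Φ = dc + c × c` (Fine–Panov 2009, §2.1; FKP 2014, §2.2), from
metric compatibility `∂_u G(p, q) = G(∇_u p, q) + G(p, ∇_u q)`, the Ricci identity
`[∇_u, ∇_v] p = R(u,v) p` for vector-valued functions, and the fact that the projection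
`so(4) → Λ⁺ ≅ (ℝ³, ×)` is a Lie algebra homomorphism (`Matrix.selfDualVec_comm`). Also:
`chartConn` is smooth on `U` (`contDiffOn_chartConn`).

Everything here is proved; no named facts are introduced.

## References

* J. Fine, D. Panov, *Symplectic Calabi–Yau manifolds, minimal surfaces and the hyperbolic
  geometry of the conifold*, J. Differential Geom. 82 (2009), §2.1. [FinePanov2009]
* J. Fine, K. Krasnov, D. Panov, *A gauge theoretic approach to Einstein 4-manifolds*,
  New York J. Math. 20 (2014), §2.2. [FineKrasnovPanov2014]
* B. O'Neill, *Semi-Riemannian geometry* (1983), Ch. 3, Prop. 3.13, Lemma 3.38. [ONeill1983]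
-/

noncomputable section

open scoped Matrix BigOperators Topology ContDiff Manifold
open Set Filter Function

namespace Literature.Geometry.Riemannian

open Literature.Geometry.Lorentzian (PseudoRiemannianMetric)
open Literature.Geometry.Lorentzian.PseudoRiemannianMetric
open Literature.Geometry.Lorentzian.MetricCoord

/-- Local notation: `ℝ³` as coordinate vectors. -/
local notation "R3" => (Fin 3 → ℝ)
/-- Local notation for the cross product. -/
local infixl:74 " ×₃ " => crossProduct

/-! ### The so(4) → Λ⁺ projection is a Lie algebra homomorphism -/

/-- The `Λ⁺`-vector of a `4 × 4` matrix: `(α₀₁ + α₂₃, α₀₂ + α₃₁, α₀₃ + α₁₂)` (for the skew matrix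
`α_{ab} = g(A e_a, e_b)` of an endomorphism in an orthonormal frame this is `selfDualVecOf`).
[cite: FineKrasnovPanov2014, §2.2] -/
def _root_.Matrix.selfDualVec (α : Matrix (Fin 4) (Fin 4) ℝ) : R3 :=
  ![α 0 1 + α 2 3, α 0 2 + α 3 1, α 0 3 + α 1 2]

/-- `selfDualVec` as a sum over Hamilton's index pairs. [folklore] -/
theorem _root_.Matrix.selfDualVec_eq_sum (α : Matrix (Fin 4) (Fin 4) ℝ) :
    α.selfDualVec = fun i ↦ ∑ k, α (selfDualIdx i k).1 (selfDualIdx i k).2 := by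
  ext i
  fin_cases i <;> simp [Matrix.selfDualVec, selfDualIdx, Fin.sum_univ_two]

/-- **The projection `so(4) → (ℝ³, ×)` is a Lie algebra homomorphism** (in the form needed for the
structure equation): for skew `α, β`,
`Σ_{(a,b) ∈ φᵢ} Σ_c (α_{bc} β_{ac} - β_{bc} α_{ac}) = -(Φ_α × Φ_β)ᵢ`. [cite: FineKrasnovPanov2014, §2.2] -/
theorem _root_.Matrix.selfDualVec_comm (α β : Matrix (Fin 4) (Fin 4) ℝ) (hα : αᵀ = -α)
    (hβ : βᵀ = -β) (i : Fin 3) :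
    ∑ k, ∑ c, (α (selfDualIdx i k).2 c * β (selfDualIdx i k).1 c -
      β (selfDualIdx i k).2 c * α (selfDualIdx i k).1 c) = -(α.selfDualVec ×₃ β.selfDualVec) i := by
  have ha : ∀ i j, α j i = -α i j := fun i j ↦ by
    have := congrFun (congrFun hα i) j; simpa using this
  have hb : ∀ i j, β j i = -β i j := fun i j ↦ by
    have := congrFun (congrFun hβ i) j; simpa using this
  have a0 : α 0 0 = 0 := by linarith [ha 0 0]
  have a1 : α 1 1 = 0 := by linarith [ha 1 1]
  have a2 : α 2 2 = 0 := by linarith [ha 2 2]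
  have a3 : α 3 3 = 0 := by linarith [ha 3 3]
  have b0 : β 0 0 = 0 := by linarith [hb 0 0]
  have b1 : β 1 1 = 0 := by linarith [hb 1 1]
  have b2 : β 2 2 = 0 := by linarith [hb 2 2]
  have b3 : β 3 3 = 0 := by linarith [hb 3 3]
  have a01 := ha 0 1; have a02 := ha 0 2; have a03 := ha 0 3
  have a12 := ha 1 2; have a13 := ha 1 3; have a23 := ha 2 3
  have b01 := hb 0 1; have b02 := hb 0 2; have b03 := hb 0 3
  have b12 := hb 1 2; have b13 := hb 1 3; have b23 := hb 2 3
  fin_cases i <;>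
    simp [Matrix.selfDualVec, selfDualIdx, Fin.sum_univ_two, Fin.sum_univ_four, cross_apply,
      a0, a1, a2, a3, b0, b1, b2, b3, a01, a02, a03, a12, a13, a23, b01, b02, b03, b12, b13, b23] <;>
    ring

/-! ### The covariant derivative of vector-valued functions along constant fields -/

section CovD

variable {E : Type*} [NormedAddCommGroup E] [NormedSpace ℝ E]

/-- **The covariant derivative of a vector-valued function along the constant field `u`**:
`∇_u p (y) = Dp(y) u + Γ_y(u, p y)` (O'Neill 1983, Ch. 3, Prop. 3.13; the coordinate formula of
`OpensChart.leviCivita_apply_eq`). [cite: ONeill1983, Ch. 3, Prop. 3.13] -/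
def covD (G : E → E →L[ℝ] E →L[ℝ] ℝ) (u : E) (p : E → E) (y : E) : E :=
  fderiv ℝ p y u + chrAt G y u (p y)

variable (G : E → E →L[ℝ] E →L[ℝ] ℝ)

/-- Unfolding `covD`. [folklore] -/
theorem covD_apply (u : E) (p : E → E) (y : E) :
    covD G u p y = fderiv ℝ p y u + chrAt G y u (p y) := rfl

/-- `covD` is additive in the direction. [folklore] -/
theorem covD_add_dir (u u' : E) (p : E → E) (y : E) :
    covD G (u + u') p y = covD G u p y + covD G u' p y := by
  simp only [covD, map_add, _root_.add_apply]
  abel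

/-- `covD` is homogeneous in the direction. [folklore] -/
theorem covD_smul_dir (r : ℝ) (u : E) (p : E → E) (y : E) :
    covD G (r • u) p y = r • covD G u p y := by
  simp only [covD, map_smul, _root_.smul_apply, smul_add]

variable {G} {V : Set E} {y : E}

/-- `covD G u p` is smooth on an open set where `p` and `G` are. [folklore] -/
theorem contDiffOn_covD [CompleteSpace E] (hG : IsMetricOn G V) {p : E → E}
    (hp : ContDiffOn ℝ ∞ p V) (u : E) : ContDiffOn ℝ ∞ (covD G u p) V := by
  have h1 : ContDiffOn ℝ ∞ (fun y ↦ fderiv ℝ p y u) V :=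
    (hp.fderiv_of_isOpen (m := ∞) hG.isOpen (le_of_eq rfl)).clm_apply contDiffOn_const
  have h2 : ContDiffOn ℝ ∞ (fun y ↦ chrAt G y u (p y)) V :=
    (hG.contDiffOn_chrAt.clm_apply contDiffOn_const).clm_apply hp
  exact h1.add h2

/-- **Metric compatibility on functions**: `∂_u G(p, q) = G(∇_u p, q) + G(p, ∇_u q)` at a point of
`V` (O'Neill 1983, Ch. 3, Prop. 3.13 with Thm. 3.11 (D4): `∂_k g_{ij} = Γ_{kij} + Γ_{kji}`).
[cite: ONeill1983, Ch. 3, Prop. 3.13] -/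
theorem fderiv_metric_apply (hG : IsMetricOn G V) (hy : y ∈ V) {p q : E → E}
    (hp : DifferentiableAt ℝ p y) (hq : DifferentiableAt ℝ q y) (u : E) :
    fderiv ℝ (fun y' ↦ G y' (p y') (q y')) y u =
      G y (covD G u p y) (q y) + G y (p y) (covD G u q y) := by
  have hGd : HasFDerivAt G (fderiv ℝ G y) y := (hG.differentiableAt hy).hasFDerivAt
  have h1 : HasFDerivAt (fun y' ↦ G y' (p y'))
      ((G y).comp (fderiv ℝ p y) + (fderiv ℝ G y).flip (p y)) y := hGd.clm_apply hp.hasFDerivAt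
  have h2 : HasFDerivAt (fun y' ↦ G y' (p y') (q y'))
      ((G y (p y)).comp (fderiv ℝ q y) + ((G y).comp (fderiv ℝ p y) +
        (fderiv ℝ G y).flip (p y)).flip (q y)) y := h1.clm_apply hq.hasFDerivAt
  rw [h2.fderiv]
  simp only [covD, _root_.add_apply, ContinuousLinearMap.comp_apply,
    ContinuousLinearMap.flip_apply, map_add, hG.fderiv_eq_chrAt hy u (p y) (q y)]
  ring

/-- **The Ricci identity for vector-valued functions**: `∇_u ∇_v p - ∇_v ∇_u p = R(u, v) p` at a
point where `p` is `C²` (`R = riemAt G`, O'Neill 1983, Ch. 3, Lemma 3.38; the constant fields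
`u, v` commute). [cite: ONeill1983, Ch. 3, Lemma 3.38] -/
theorem covD_covD_sub [CompleteSpace E] (hG : IsMetricOn G V) (hy : y ∈ V) {p : E → E}
    (hp : ContDiffOn ℝ ∞ p V) (u v : E) :
    covD G u (covD G v p) y - covD G v (covD G u p) y = riemAt G y u v (p y) := by
  have hpy : ContDiffAt ℝ ∞ p y := (hp y hy).contDiffAt (hG.mem_nhds hy)
  have hpd : DifferentiableAt ℝ p y := hpy.differentiableAt (by simp)
  have hDp : DifferentiableAt ℝ (fderiv ℝ p) y :=
    (((hp.fderiv_of_isOpen (m := ∞) hG.isOpen (le_of_eq rfl)) y hy).contDiffAt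
      (hG.mem_nhds hy)).differentiableAt (by simp)
  have hΓ : DifferentiableAt ℝ (chrAt G) y := hG.differentiableAt_chrAt hy
  -- derivative of `y' ↦ covD G v p y'` in the direction `u`
  have key : ∀ u v : E, fderiv ℝ (covD G v p) y u =
      fderiv ℝ (fderiv ℝ p) y u v + (fderiv ℝ (chrAt G) y u v (p y) + chrAt G y v (fderiv ℝ p y u)) := by
    intro u v
    have h1 : HasFDerivAt (fun y' ↦ fderiv ℝ p y' v) ((fderiv ℝ (fderiv ℝ p) y).flip v) y :=
      hasFDerivAt_clm_apply_const hDp.hasFDerivAt v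
    have h2 : HasFDerivAt (fun y' ↦ chrAt G y' v) ((fderiv ℝ (chrAt G) y).flip v) y :=
      hasFDerivAt_clm_apply_const hΓ.hasFDerivAt v
    have h3 : HasFDerivAt (fun y' ↦ chrAt G y' v (p y'))
        ((chrAt G y v).comp (fderiv ℝ p y) + ((fderiv ℝ (chrAt G) y).flip v).flip (p y)) y :=
      h2.clm_apply hpd.hasFDerivAt
    have h4 : HasFDerivAt (covD G v p) _ y := h1.add h3
    rw [h4.fderiv]
    simp only [_root_.add_apply, ContinuousLinearMap.comp_apply, ContinuousLinearMap.flip_apply]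
    abel
  have hsymm : fderiv ℝ (fderiv ℝ p) y u v = fderiv ℝ (fderiv ℝ p) y v u := by
    have hr : minSmoothness ℝ 2 ≤ ∞ := by
      rw [minSmoothness_of_isRCLikeNormedField]; exact WithTop.coe_le_coe.2 le_top
    exact hpy.isSymmSndFDerivAt hr u v
  have e1 : covD G u (covD G v p) y = fderiv ℝ (covD G v p) y u + chrAt G y u (covD G v p y) := rfl
  have e2 : covD G v (covD G u p) y = fderiv ℝ (covD G u p) y v + chrAt G y v (covD G u p y) := rfl
  rw [e1, e2, key u v, key v u, hsymm, riemAt_apply]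
  simp only [covD_apply, map_add]
  abel

end CovD

/-! ### The connection and curvature vectors of `Λ⁺` in a frame -/

section Frame

variable {E : Type*} [NormedAddCommGroup E] [NormedSpace ℝ E]
  (G : E → E →L[ℝ] E →L[ℝ] ℝ) (ê : Fin 4 → E → E)

/-- **The connection vector of `Λ⁺` in the frame `ê`**: `(c(u))ᵢ = Σ_{(a,b) ∈ φᵢ} G(ê_b, ∇_u ê_a)`
at `y` (the chart form of `selfDualConnectionVec`). [cite: FinePanov2009, §2.1] -/
def chartConnVec (y : E) (u : E) : R3 :=
  fun i ↦ ∑ k, G y (ê (selfDualIdx i k).2 y) (covD G u (ê (selfDualIdx i k).1) y)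

/-- **The curvature vector of `Λ⁺` in the frame `ê`**:
`(Φ(u,v))ᵢ = Σ_{(a,b) ∈ φᵢ} G(R(u,v) ê_a, ê_b)` at `y`, `R = riemAt G` (the chart form of
`selfDualCurvatureVec`). [cite: FineKrasnovPanov2014, §2.1–2.2] -/
def chartCurvVec (y : E) (u v : E) : R3 :=
  fun i ↦ ∑ k, G y (riemAt G y u v (ê (selfDualIdx i k).1 y)) (ê (selfDualIdx i k).2 y)

/-- The connection vector is additive in the direction. [folklore] -/
theorem chartConnVec_add (y : E) (u u' : E) :
    chartConnVec G ê y (u + u') = chartConnVec G ê y u + chartConnVec G ê y u' := by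
  ext i
  simp only [chartConnVec, covD_add_dir, map_add, Pi.add_apply, Finset.sum_add_distrib]

/-- The connection vector is homogeneous in the direction. [folklore] -/
theorem chartConnVec_smul (y : E) (r : ℝ) (u : E) :
    chartConnVec G ê y (r • u) = r • chartConnVec G ê y u := by
  ext i
  simp only [chartConnVec, covD_smul_dir, map_smul, Pi.smul_apply, smul_eq_mul, Finset.mul_sum]

variable [FiniteDimensional ℝ E]

/-- **The connection form of `Λ⁺` in the frame `ê`** as a map `E → (E →L[ℝ] ℝ³)` (the datum `c` of
`TwistorCouplingModel.lean`). [cite: FinePanov2009, §2.1] -/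
def chartConn (y : E) : E →L[ℝ] R3 :=
  LinearMap.toContinuousLinearMap
    { toFun := chartConnVec G ê y
      map_add' := chartConnVec_add G ê y
      map_smul' := chartConnVec_smul G ê y }

/-- `chartConn` is `chartConnVec`. [folklore] -/
@[simp] theorem chartConn_apply (y u : E) : chartConn G ê y u = chartConnVec G ê y u := rfl

variable {G ê} {V : Set E} [CompleteSpace E]

/-- **The connection form is smooth** where the metric components and the frame are.
[folklore] -/
theorem contDiffOn_chartConn (hG : IsMetricOn G V) (hê : ∀ a, ContDiffOn ℝ ∞ (ê a) V) :
    ContDiffOn ℝ ∞ (chartConn G ê) V := by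
  refine contDiffOn_clm_apply.2 fun u ↦ ?_
  refine contDiffOn_pi.2 fun i ↦ ?_
  have h : (fun y ↦ chartConn G ê y u i) =
      fun y ↦ ∑ k, G y (ê (selfDualIdx i k).2 y) (covD G u (ê (selfDualIdx i k).1) y) := rfl
  rw [h]
  refine ContDiffOn.sum fun k _ ↦ ?_
  exact (hG.contDiffOn.clm_apply (hê _)).clm_apply (contDiffOn_covD hG (hê _) u)

omit [FiniteDimensional ℝ E] [CompleteSpace E] in
/-- Components of the derivative of an operator-valued map: `(DF(y) u)(v)ᵢ = ∂_u (F(·)(v)ᵢ)`.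
[folklore] -/
theorem fderiv_clm_apply_pi {F : E → E →L[ℝ] R3} {y : E} (hF : DifferentiableAt ℝ F y)
    (u v : E) (i : Fin 3) :
    fderiv ℝ F y u v i = fderiv ℝ (fun y' ↦ F y' v i) y u := by
  have h1 : HasFDerivAt (fun y' ↦ F y' v) ((fderiv ℝ F y).flip v) y :=
    hasFDerivAt_clm_apply_const hF.hasFDerivAt v
  have h2 : HasFDerivAt (fun y' ↦ F y' v i)
      ((ContinuousLinearMap.proj i : R3 →L[ℝ] ℝ).comp ((fderiv ℝ F y).flip v)) y :=
    (ContinuousLinearMap.proj (R := ℝ) (φ := fun _ : Fin 3 ↦ ℝ) i).hasFDerivAt.comp y h1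
  rw [h2.fderiv]
  rfl

variable {U : TopologicalSpace.Opens E}
  {g : PseudoRiemannianMetric 𝓘(ℝ, E) ∞ E (TangentSpace 𝓘(ℝ, E) : U → Type _)}

omit [CompleteSpace E] in
/-- **Skew-symmetry of the connection matrix of an orthonormal frame**:
`G(∇_u ê_a, ê_b) + G(∇_u ê_b, ê_a) = 0` on `U` (differentiate `G(ê_a, ê_b) = δ_{ab}`).
[cite: FinePanov2009, §2.1] -/
theorem metric_covD_frame_add (hG : ∀ y : U, g.val y = G y) (hê : ∀ a, ContDiffOn ℝ ∞ (ê a) U)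
    (hon : ∀ y : U, g.IsOrthonormalFrame y (fun a ↦ ê a y)) (y : U) (u : E) (a b : Fin 4) :
    G y (covD G u (ê a) y) (ê b y) + G y (covD G u (ê b) y) (ê a y) = 0 := by
  classical
  have hGm := Literature.Geometry.Lorentzian.OpensChart.isMetricOn_repr hG
  have hy : (y : E) ∈ (U : Set E) := y.2
  have hda : DifferentiableAt ℝ (ê a) y :=
    (((hê a) y hy).contDiffAt (hGm.mem_nhds hy)).differentiableAt (by simp)
  have hdb : DifferentiableAt ℝ (ê b) y :=
    (((hê b) y hy).contDiffAt (hGm.mem_nhds hy)).differentiableAt (by simp)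
  have h1 := fderiv_metric_apply hGm hy hda hdb u
  -- the paired function is locally constant
  have hconst : (fun y' : E ↦ G y' (ê a y') (ê b y')) =ᶠ[𝓝 (y : E)]
      fun _ ↦ (if a = b then (1 : ℝ) else 0) := by
    filter_upwards [hGm.mem_nhds hy] with y' hy'
    have h := (hon ⟨y', hy'⟩).val_ite a b
    rw [hG ⟨y', hy'⟩] at h
    exact h
  have h0 : fderiv ℝ (fun y' : E ↦ G y' (ê a y') (ê b y')) y u = 0 := by
    rw [hconst.fderiv_eq, fderiv_fun_const]; rfl
  rw [h0] at h1
  rw [hGm.symm y hy (covD G u (ê b) y) (ê a y)]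
  linarith

/-- **The structure equation `Φ = dc + c × c`**: for a smooth `g`-orthonormal frame field `ê` on
the open set `U` (`dim E = 4`), the curvature vector of the connection form `chartConn G ê`
(`modelCurv`: `dc + c × c`) is the curvature vector `chartCurvVec` of `Λ⁺` built from the Riemann
tensor (Fine–Panov 2009, §2.1: `F_∇ = dA + A ∧ A` for the induced `SO(3)`-connection;
FKP 2014, §2.2). Proof: `∂_u c(v)ᵢ = Σ (G(∇_u ê_b, ∇_v ê_a) + G(ê_b, ∇_u ∇_v ê_a))` (metric
compatibility); the second-order terms give `Σ G(R(u,v) ê_a, ê_b)` (Ricci identity), the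
first-order ones `-(c(u) × c(v))ᵢ` (`Matrix.selfDualVec_comm` with Parseval).
[cite: FinePanov2009, §2.1] -/
theorem modelCurv_chartConn (hG : ∀ y : U, g.val y = G y) (hE : Module.finrank ℝ E = 4)
    (hê : ∀ a, ContDiffOn ℝ ∞ (ê a) U)
    (hon : ∀ y : U, g.IsOrthonormalFrame y (fun a ↦ ê a y)) (y : U) (u v : E) :
    modelCurv (chartConn G ê) y u v = chartCurvVec G ê y u v := by
  classical
  have hGm := Literature.Geometry.Lorentzian.OpensChart.isMetricOn_repr hG
  have hy : (y : E) ∈ (U : Set E) := y.2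
  have hdiffc : DifferentiableAt ℝ (chartConn G ê) y :=
    (((contDiffOn_chartConn hGm hê) y hy).contDiffAt (hGm.mem_nhds hy)).differentiableAt
      (by simp)
  have hde : ∀ a, DifferentiableAt ℝ (ê a) y := fun a ↦
    (((hê a) y hy).contDiffAt (hGm.mem_nhds hy)).differentiableAt (by simp)
  have hdcov : ∀ w a, DifferentiableAt ℝ (covD G w (ê a)) y := fun w a ↦
    (((contDiffOn_covD hGm (hê a) w) y hy).contDiffAt (hGm.mem_nhds hy)).differentiableAt
      (by simp)
  -- (S2) the derivative of the connection vector
  have hD : ∀ w w' : E, ∀ i : Fin 3, fderiv ℝ (chartConn G ê) y w w' i =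
      ∑ k, (G y (covD G w (ê (selfDualIdx i k).2) y) (covD G w' (ê (selfDualIdx i k).1) y) +
        G y (ê (selfDualIdx i k).2 y) (covD G w (covD G w' (ê (selfDualIdx i k).1)) y)) := by
    intro w w' i
    rw [fderiv_clm_apply_pi hdiffc]
    have hf : (fun y' ↦ chartConn G ê y' w' i) = fun y' ↦
        ∑ k, G y' (ê (selfDualIdx i k).2 y') (covD G w' (ê (selfDualIdx i k).1) y') := rfl
    rw [hf, fderiv_fun_sum fun k _ ↦ ?_]
    · simp only [FunLike.coe_sum, Finset.sum_apply]
      exact Finset.sum_congr rfl fun k _ ↦ fderiv_metric_apply hGm hy (hde _) (hdcov _ _) w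
    · exact ((hGm.differentiableAt hy).clm_apply (hde _)).clm_apply (hdcov _ _)
  -- the connection matrices and their skewness
  set α : Matrix (Fin 4) (Fin 4) ℝ := Matrix.of fun a b ↦ G y (covD G u (ê a) y) (ê b y) with hα
  set β : Matrix (Fin 4) (Fin 4) ℝ := Matrix.of fun a b ↦ G y (covD G v (ê a) y) (ê b y) with hβ
  have hαs : αᵀ = -α := by
    ext a b
    simp only [Matrix.transpose_apply, Matrix.neg_apply, hα, Matrix.of_apply]
    linarith [metric_covD_frame_add hG hê hon y u a b]
  have hβs : βᵀ = -β := by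
    ext a b
    simp only [Matrix.transpose_apply, Matrix.neg_apply, hβ, Matrix.of_apply]
    linarith [metric_covD_frame_add hG hê hon y v a b]
  have hcu : chartConn G ê y u = α.selfDualVec := by
    rw [Matrix.selfDualVec_eq_sum]
    ext i
    simp only [chartConn_apply, chartConnVec, hα, Matrix.of_apply]
    exact Finset.sum_congr rfl fun k _ ↦ hGm.symm y hy _ _
  have hcv : chartConn G ê y v = β.selfDualVec := by
    rw [Matrix.selfDualVec_eq_sum]
    ext i
    simp only [chartConn_apply, chartConnVec, hβ, Matrix.of_apply]
    exact Finset.sum_congr rfl fun k _ ↦ hGm.symm y hy _ _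
  -- Parseval on the first-order terms
  have hP : ∀ a b : E, G y a b = ∑ c, G y a (ê c y) * G y b (ê c y) := fun a b ↦ by
    have h := val_eq_sum_mul (hon y) hE a b
    rw [hG y] at h
    exact h
  ext i
  rw [modelCurv, Pi.add_apply, Pi.sub_apply, hD u v i, hD v u i, hcu, hcv]
  have hfirst : ∑ k, (G y (covD G u (ê (selfDualIdx i k).2) y) (covD G v (ê (selfDualIdx i k).1) y) -
      G y (covD G v (ê (selfDualIdx i k).2) y) (covD G u (ê (selfDualIdx i k).1) y)) =
      -(α.selfDualVec ×₃ β.selfDualVec) i := by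
    rw [← Matrix.selfDualVec_comm α β hαs hβs i]
    refine Finset.sum_congr rfl fun k _ ↦ ?_
    rw [hP (covD G u _ y), hP (covD G v _ y), ← Finset.sum_sub_distrib]
    rfl
  have hsecond : ∑ k, (G y (ê (selfDualIdx i k).2 y) (covD G u (covD G v (ê (selfDualIdx i k).1)) y) -
      G y (ê (selfDualIdx i k).2 y) (covD G v (covD G u (ê (selfDualIdx i k).1)) y)) =
      chartCurvVec G ê y u v i := by
    simp only [chartCurvVec]
    refine Finset.sum_congr rfl fun k _ ↦ ?_
    rw [← map_sub, covD_covD_sub hGm hy (hê _) u v, hGm.symm y hy]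
  have hsplit : ∑ k, (G y (covD G u (ê (selfDualIdx i k).2) y) (covD G v (ê (selfDualIdx i k).1) y) +
        G y (ê (selfDualIdx i k).2 y) (covD G u (covD G v (ê (selfDualIdx i k).1)) y)) -
      ∑ k, (G y (covD G v (ê (selfDualIdx i k).2) y) (covD G u (ê (selfDualIdx i k).1) y) +
        G y (ê (selfDualIdx i k).2 y) (covD G v (covD G u (ê (selfDualIdx i k).1)) y)) =
      ∑ k, (G y (covD G u (ê (selfDualIdx i k).2) y) (covD G v (ê (selfDualIdx i k).1) y) -
        G y (covD G v (ê (selfDualIdx i k).2) y) (covD G u (ê (selfDualIdx i k).1) y)) +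
      ∑ k, (G y (ê (selfDualIdx i k).2 y) (covD G u (covD G v (ê (selfDualIdx i k).1)) y) -
        G y (ê (selfDualIdx i k).2 y) (covD G v (covD G u (ê (selfDualIdx i k).1)) y)) := by
    rw [← Finset.sum_sub_distrib, ← Finset.sum_add_distrib]
    refine Finset.sum_congr rfl fun k _ ↦ ?_
    ring
  rw [hsplit, hfirst, hsecond]
  ring

end Frame

end Literature.Geometry.Riemannian
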